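/-
Origin: expansion seat `planner-pub-hodgecm-pv01-g2-0`, handover #5 v2 (primed name) 2026-08-18T05:11:57Z (`HOME/pub-hodgecm-pv01-g2/lean/Pv01g2/RealApproximationGU.lean`, md5 8cb84320, 71 lines);
landed by the gen-6 packager in gate run 22 as `HodgeCM/PerL34/RealApproximationGU.lean` (import ^import CfHM4\.→import HodgeCM.Literature. ×1; import ^import Pv[0-9]+g[0-9]+\.→import HodgeCM.PerL34. ×1; stripped 1 #print/#check/#eval lines).
-/
/-
Copyright: pub-hodgecm formalisation cell (harness21, 2026). New file (not vendored).
Origin: HOME/pub-hodgecm-pv01-g2/lean/Pv01g2/RealApproximationGU.lean (WIP module `Pv01g2.RealApproximationGU`;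
intended final place `HodgeCM/PerL34/RealApproximationGU.lean` = module `HodgeCM.PerL34.RealApproximationGU`).
IMPORT REWRITES on landing: `CfHM4.RealApproximation` → `HodgeCM.Literature.RealApproximation`
(cf-hasseminkowski-g4's handover: v1 04:54:50Z md5 90162d39fe53 OR v2 05:09Z md5 bfc0e30be33e — this file
compiles against EITHER; checked against v2) and
`Pv01g2.RealApproximationBall` → `HodgeCM.PerL34.RealApproximationBall` (pv01-g2's handover of 04:59:07Z).
Lands AFTER both.  (seat planner-pub-hodgecm-pv01-g2-0)
-/
import Summits.HodgeConjecture.HodgeCM.Literature.RealApproximation_3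
import Summits.HodgeConjecture.HodgeCM.PerL34.RealApproximationBall

/-!
# Crosswalk: cf-hasseminkowski-g4's `RealApproximation_GU` ↔ pv01-g2's `dense_Delta`

v2 (05:13Z): cf-hasseminkowski-g4's v2 of `HodgeCM/Literature/RealApproximation.lean` (bfc0e30be33e) now proves
`HodgeCM.Literature.RealApproximation_GU_holds` ITSELF (Cayley over the CM field); to avoid the FQ clash flagged in
their STATUS line of 05:10:14Z, this file's proof of the same `Prop` is renamed
`HodgeCM.Literature.RealApproximation_GU_holds'` — a SECOND, INDEPENDENT kernel proof (via
`HodgeCM.PerL34.RealApproximation.dense_Delta`: Cayley over a dense `conj`-stable subfield `K ⊆ ℂ`, any rank `n`,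
`HodgeCM/PerL34/RealApproximation{,Ball}.lean`).  If the packager lands their v1 instead, `_GU_holds'` is the only
proof in the package and nothing else changes.  The crosswalk `toU21_eq` (the two seats' maps
`toU21 : G_U(L₀) →* U(2,1)`, theirs with `hT : … = signatureMatrix 2`, ours with `… = BallModel.J`, are the same
function `g ↦ T⁻¹ g^{ι₁} T`) is what lets either density theorem serve either consumer.

`HodgeCM.Literature.RealApproximation_GU` is the typed special case of real approximation [GH24 Thm 2.5.2] /
[PR Thm 7.7] / [San Cor 3.5(iii)] / [Bor09 Cor 3.13] for `G_U = U(V₃,h)` at the place of `ι₁` (PerL v5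
ll. 672–674); no citation is needed any more — it is a theorem (twice).
-/

set_option autoImplicit false

open scoped Matrix

namespace HodgeCM
namespace Literature
namespace RealApproximation

open Literature.AlgebraicGeometry.ShimuraVarieties (signatureMatrix)
open HodgeCM.PerL34.BallModel (GL3 U21)

variable {L : CMField} {ι₁ : L →+* ℂ}

/-- The two `toU21`s (cf-HM-g4's, with `hT : … = signatureMatrix 2`, and pv01-g2's, with `… = BallModel.J`) agree. -/
theorem toU21_eq (V : HermSpace3 L ι₁) (T : GL3)
    (hT : (T : Matrix (Fin 3) (Fin 3) ℂ)ᴴ * V.Hm.map ι₁ * (T : Matrix (Fin 3) (Fin 3) ℂ) = signatureMatrix 2) :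
    ⇑(toU21 V T hT) = ⇑(HodgeCM.PerL34.RealApproximation.toU21 V T (hT.trans signatureMatrix_two_eq_J)) := by
  funext g
  apply Subtype.ext
  apply Units.ext
  change HodgeCM.PerL34.BallModel.mat (toU21 V T hT g) =
    HodgeCM.PerL34.BallModel.mat (HodgeCM.PerL34.RealApproximation.toU21 V T (hT.trans signatureMatrix_two_eq_J) g)
  rw [mat_toU21, HodgeCM.PerL34.RealApproximation.mat_toU21]

end RealApproximation

/-- **RA-GU is a theorem** (second, independent proof; same statement as cf-hasseminkowski-g4's
`RealApproximation_GU_holds` of their v2): for every CM field `L`, `ι₁`, hermitian 3-space `V` of signature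
`(2,1)` at `ι₁` and Sylvester frame `T`, the image of `G_U(L₀)` under `g ↦ T⁻¹ g^{ι₁} T` is dense in `U(2,1)`. -/
theorem RealApproximation_GU_holds' : RealApproximation_GU := by
  intro L ι₁ V T hT
  rw [RealApproximation.toU21_eq]
  have hd := HodgeCM.PerL34.RealApproximation.dense_Delta V T (hT.trans RealApproximation.signatureMatrix_two_eq_J)
  rw [HodgeCM.PerL34.RealApproximation.Delta, MonoidHom.coe_range] at hd
  exact hd

end Literature
end HodgeCM

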